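import Literature.NumberTheory.LFunctions.VanDerCorputZeta
import Mathlib.Analysis.SpecialFunctions.Trigonometric.Cotangent
import HarnessLib

/-!
# The sharp Kusmin–Landau inequality (Landau's `cot(πθ/2)`; Hiary–Patel–Yang, Lemma 2.3)

Topic `Literature/NumberTheory/LFunctions`. The tree's discrete Kusmin–Landau inequality
`Literature.NumberTheory.LFunctions.VdC.kusminLandau` (`VanDerCorputZeta.lean`, Graham–Kolesnik
Thm 2.1) carries the constant `2/δ`. The explicit van der Corput theory behind the explicit bounds
for `ζ(1/2 + it)` (Hiary–Patel–Yang 2024, Yang 2024, Patel–Yang 2024) rests on the SHARP form, due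
to Landau (1928): if `f'` is monotonic and `θ ≤ f' ≤ 1 - θ` then `|∑ e(f(n))| ≤ cot(πθ/2)`
(`≤ 2/(πθ)`), and on its asymmetric generalisation (Karamata–Tomić; Hiary–Patel–Yang 2024,
Lemma 2.3 "generalised Cheng–Graham lemma"): "Let `f(x)` be a real-valued function with a
monotonic and continuous derivative on `[a, b)`, satisfying `ℓ + U⁻¹ ≤ f'(x) ≤ ℓ + 1 - V⁻¹`
(`x ∈ [a, b)`) for some `U, V > 1` and some integer `ℓ`. Then `|∑_{a ≤ n < b} e(f(n))| ≤ (U + V)/π`."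
(Yang 2024, eq. (2.2)–(2.3): `S_f(a, N) ≤ 2/(πλ₁)`, resp. `≤ (λ₁⁻¹ + μ₁⁻¹)/π`.)

Everything here is PROVED, following the printed proof of Hiary–Patel–Yang §5 (Abel summation
against `G(n) = 1/(1 - e(g(n)))`, `|G| = 1/(2 sin πg)` (`|e(x) - 1| = 2|sin πx|`), telescoping of `cot(πg(n))`, and the
half-angle identities `(1 + cos πx)/sin πx = cot(πx/2)`, `(1 - cos πx)/sin πx = tan(πx/2)`), in
the discrete setting of the tree (phases `φ : ℤ → ℝ`, increments `θ(n) = φ(n+1) - φ(n)`):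

* `Literature.NumberTheory.LFunctions.VdC.kusminLandau_cot` — increments nondecreasing (or
  nonincreasing, `…_cot'`) and in `[ν + λ, ν + 1 - μ]` on `m ≤ n < M` (`m < M`):
  `‖∑_{n=m}^{M} e(φ(n))‖ ≤ (cot(πλ/2) + cot(πμ/2))/2`;
* `Literature.NumberTheory.LFunctions.VdC.kusminLandau_sharp` — the same with the bound
  `(λ⁻¹ + μ⁻¹)/π` (any `m, M`, assuming `λ + μ ≤ 1`);
* `Literature.NumberTheory.LFunctions.VdC.kusminLandau_deriv`, `…_deriv_Ioc` — **Hiary–Patel–Yang's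
  Lemma 2.3** for a phase `f` differentiable on `[a, b]` with monotone derivative
  `ν + λ ≤ f' ≤ ν + 1 - μ`: `‖∑_{a ≤ n ≤ b} e(f(n))‖ ≤ (λ⁻¹ + μ⁻¹)/π` (no side condition), and the
  symmetric case `‖∑‖ ≤ 2/(πλ)` (`…_deriv_symm`).

## References

* G. A. Hiary, D. Patel, A. Yang, *An improved explicit estimate for `ζ(1/2 + it)`*, J. Number
  Theory 256 (2024), 195–217 = arXiv:2207.02366, Lemma 2.3 and §5 (its proof).
  [cite: HiaryPatelYang2024, Lemma 2.3]
* E. Landau, *Über eine trigonometrische Summe*, Nachr. Ges. Wiss. Göttingen (1928), 21–24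
  (the bound `cot(πθ/2)` and its sharpness).
* A. Yang, *Explicit bounds on `ζ(s)` in the critical strip and a zero-free region*, J. Math.
  Anal. Appl. 534 (2024) = arXiv:2301.03165, eqs. (2.2)–(2.3).
* S. W. Graham, G. Kolesnik, *Van der Corput's Method of Exponential Sums*, LMS LN 126 (1991),
  Thm 2.1.
-/

noncomputable section

open Finset Real

namespace Literature.NumberTheory.LFunctions
namespace VdC

/-! ### Exact norms of the Kusmin–Landau coefficients -/

/-- `‖c(x)‖ = 1/(2|sin(πx)|)` for the Kusmin–Landau coefficient `c(x) = 1/(e(x) - 1)`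
(`‖e(x) - 1‖ = 2|sin(πx)|`). [folklore] -/
theorem norm_cKL_eq {x : ℝ} (hx : Real.sin (π * x) ≠ 0) : ‖cKL x‖ = 1 / (2 * |Real.sin (π * x)|) := by
  have hn : ‖e x - 1‖ = 2 * |Real.sin (π * x)| := by
    rw [e_sub_one_eq, norm_mul, norm_mul, Complex.norm_real, Real.norm_eq_abs, Complex.norm_two]
    have h : ‖(-(Real.sin (π * x) : ℂ) + (Real.cos (π * x) : ℂ) * Complex.I)‖ = 1 := by
      have := Complex.norm_add_mul_I (-Real.sin (π * x)) (Real.cos (π * x))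
      rw [Complex.ofReal_neg] at this
      rw [this, neg_sq, Real.sin_sq_add_cos_sq, Real.sqrt_one]
    rw [h, mul_one]
  have h := congrArg (‖·‖) (cKL_mul_e_sub_one hx)
  simp only [norm_mul, norm_one, hn] at h
  have hpos : 0 < 2 * |Real.sin (π * x)| := by positivity
  field_simp
  linarith

/-- `c(x) + 1 = c(x) e(x)`. [folklore] -/
theorem cKL_add_one {x : ℝ} (hx : Real.sin (π * x) ≠ 0) : cKL x + 1 = cKL x * e x := by
  have h := cKL_mul_e_sub_one hx
  linear_combination -h

/-- `‖c(x) + 1‖ = ‖c(x)‖`. [folklore] -/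
theorem norm_cKL_add_one {x : ℝ} (hx : Real.sin (π * x) ≠ 0) : ‖cKL x + 1‖ = ‖cKL x‖ := by
  rw [cKL_add_one hx, norm_mul, norm_e, mul_one]

/-! ### Half-angle identities and elementary bounds for `cot` -/

/-- `(1 + cos πx)/sin πx = cot(πx/2)`, i.e. `1/sin πx + cot πx = cot(πx/2)`, for `0 < x < 1`.
[folklore] -/
theorem inv_sin_add_cotπ {x : ℝ} (h0 : 0 < x) (h1 : x < 1) :
    1 / Real.sin (π * x) + cotπ x = Real.cot (π * x / 2) := by
  have hπ := Real.pi_pos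
  set u : ℝ := π * x / 2 with hu
  have hu0 : 0 < u := by positivity
  have hu1 : u < π / 2 := by rw [hu]; nlinarith
  have hsu : 0 < Real.sin u := Real.sin_pos_of_pos_of_lt_pi hu0 (by linarith)
  have hcu : 0 < Real.cos u := Real.cos_pos_of_mem_Ioo ⟨by linarith, hu1⟩
  have hx2 : π * x = 2 * u := by rw [hu]; ring
  unfold cotπ
  rw [hx2, Real.sin_two_mul, Real.cos_two_mul, Real.cot_eq_cos_div_sin]
  have hc2 : Real.cos u ^ 2 = 1 - Real.sin u ^ 2 := by
    have := Real.sin_sq_add_cos_sq u; linarith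
  field_simp
  nlinarith [hc2]

/-- `(1 - cos πx)/sin πx = tan(πx/2)`, i.e. `1/sin πx - cot πx = tan(πx/2)`, for `0 < x < 1`.
[folklore] -/
theorem inv_sin_sub_cotπ {x : ℝ} (h0 : 0 < x) (h1 : x < 1) :
    1 / Real.sin (π * x) - cotπ x = Real.tan (π * x / 2) := by
  have hπ := Real.pi_pos
  set u : ℝ := π * x / 2 with hu
  have hu0 : 0 < u := by positivity
  have hu1 : u < π / 2 := by rw [hu]; nlinarith
  have hsu : 0 < Real.sin u := Real.sin_pos_of_pos_of_lt_pi hu0 (by linarith)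
  have hcu : 0 < Real.cos u := Real.cos_pos_of_mem_Ioo ⟨by linarith, hu1⟩
  have hx2 : π * x = 2 * u := by rw [hu]; ring
  unfold cotπ
  rw [hx2, Real.sin_two_mul, Real.cos_two_mul, Real.tan_eq_sin_div_cos]
  have hc2 : Real.cos u ^ 2 = 1 - Real.sin u ^ 2 := by
    have := Real.sin_sq_add_cos_sq u; linarith
  field_simp
  nlinarith [hc2]

/-- `cot y ≤ 1/y` for `0 < y < π/2` (from `y ≤ tan y`). [folklore] -/
theorem cot_le_inv {y : ℝ} (h0 : 0 < y) (h1 : y < π / 2) : Real.cot y ≤ 1 / y := by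
  have hs : 0 < Real.sin y := Real.sin_pos_of_pos_of_lt_pi h0 (by linarith [Real.pi_pos])
  have hc : 0 < Real.cos y := Real.cos_pos_of_mem_Ioo ⟨by linarith, h1⟩
  have ht := Real.le_tan h0.le h1
  rw [Real.tan_eq_sin_div_cos, le_div_iff₀ hc] at ht
  rw [Real.cot_eq_cos_div_sin, div_le_div_iff₀ hs h0]
  linarith

/-- `cot(πx/2) ≤ 2/(πx)` for `0 < x < 1`. [folklore] -/
theorem cot_pi_mul_div_two_le {x : ℝ} (h0 : 0 < x) (h1 : x < 1) :
    Real.cot (π * x / 2) ≤ 2 / (π * x) := by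
  have hπ := Real.pi_pos
  have h := cot_le_inv (y := π * x / 2) (by positivity) (by nlinarith)
  rw [one_div, inv_div] at h
  exact h

/-- `cot` is nonincreasing on `(0, π)`: `cot b ≤ cot a` for `0 < a ≤ b < π`. [folklore] -/
theorem cot_le_cot {a b : ℝ} (ha : 0 < a) (hab : a ≤ b) (hb : b < π) : Real.cot b ≤ Real.cot a := by
  have hsa : 0 < Real.sin a := Real.sin_pos_of_pos_of_lt_pi ha (by linarith)
  have hsb : 0 < Real.sin b := Real.sin_pos_of_pos_of_lt_pi (by linarith) hb
  rw [Real.cot_eq_cos_div_sin, Real.cot_eq_cos_div_sin, div_le_div_iff₀ hsb hsa, ← sub_nonneg]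
  have : Real.cos a * Real.sin b - Real.cos b * Real.sin a = Real.sin (b - a) := by
    rw [Real.sin_sub]; ring
  rw [this]
  exact Real.sin_nonneg_of_nonneg_of_le_pi (by linarith) (by linarith)

/-- `0 ≤ cot y` for `0 < y ≤ π/2`. [folklore] -/
theorem cot_nonneg {y : ℝ} (h0 : 0 < y) (h1 : y ≤ π / 2) : 0 ≤ Real.cot y := by
  rw [Real.cot_eq_cos_div_sin]
  exact div_nonneg (Real.cos_nonneg_of_mem_Icc ⟨by linarith, h1⟩)
    (Real.sin_nonneg_of_nonneg_of_le_pi h0.le (by linarith [Real.pi_pos]))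

/-- `tan(πx/2) ≤ cot(πμ/2)` for `0 < x ≤ 1 - μ`, `0 < μ` (`tan(π(1-μ)/2) = cot(πμ/2)` and `tan`
is increasing). [folklore] -/
theorem tan_le_cot_of_le_one_sub {x μ : ℝ} (h0 : 0 < x) (hμ : 0 < μ) (hx : x ≤ 1 - μ) :
    Real.tan (π * x / 2) ≤ Real.cot (π * μ / 2) := by
  have hπ := Real.pi_pos
  have hμ1 : μ < 1 := by linarith
  have e1 : Real.cot (π * μ / 2) = Real.tan (π * (1 - μ) / 2) := by
    rw [show π * (1 - μ) / 2 = π / 2 - π * μ / 2 by ring, Real.tan_pi_div_two_sub,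
      Real.tan_eq_sin_div_cos, Real.cot_eq_cos_div_sin, inv_div]
  rw [e1]
  have hI1 : π * x / 2 ∈ Set.Ioo (-(π / 2)) (π / 2) := ⟨by nlinarith, by nlinarith⟩
  have hI2 : π * (1 - μ) / 2 ∈ Set.Ioo (-(π / 2)) (π / 2) := ⟨by nlinarith, by nlinarith⟩
  exact Real.strictMonoOn_tan.monotoneOn hI1 hI2 (by nlinarith)

/-! ### The sharp discrete Kusmin–Landau inequality -/

/-- **Sharp Kusmin–Landau inequality, discrete form** (Landau 1928; Hiary–Patel–Yang 2024,
Lemma 2.3 and §5). Let `φ : ℤ → ℝ`, `θ(n) = φ(n+1) - φ(n)`. If on `m ≤ n < M` (`m < M`) the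
increments satisfy `ν + λ ≤ θ(n) ≤ ν + 1 - μ` for an integer `ν` and `λ, μ > 0`, and `θ` is
nondecreasing there, then `‖∑_{n=m}^{M} e(φ(n))‖ ≤ (cot(πλ/2) + cot(πμ/2))/2`.
[cite: HiaryPatelYang2024, Lemma 2.3 (proof, §5 eq. before (5.4))] -/
theorem kusminLandau_cot {φ : ℤ → ℝ} {m M ν : ℤ} {lam mu : ℝ} (hlam : 0 < lam) (hmu : 0 < mu)
    (hmM : m < M)
    (hθ : ∀ n : ℤ, m ≤ n → n < M →
      (ν : ℝ) + lam ≤ φ (n + 1) - φ n ∧ φ (n + 1) - φ n ≤ ν + 1 - mu)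
    (hmono : ∀ n : ℤ, m ≤ n → n + 1 < M → φ (n + 1) - φ n ≤ φ (n + 2) - φ (n + 1)) :
    ‖∑ n ∈ Finset.Icc m M, e (φ n)‖ ≤ (Real.cot (π * lam / 2) + Real.cot (π * mu / 2)) / 2 := by
  have hπ := Real.pi_pos
  -- reindex: n = m + i, i ∈ range (L+1), L ≥ 1
  obtain ⟨L, rfl⟩ : ∃ L : ℕ, M = m + L := ⟨(M - m).toNat, by omega⟩
  have hLpos : 1 ≤ L := by omega
  set z : ℕ → ℂ := fun i => e (φ (m + i)) with hz
  set θ' : ℕ → ℝ := fun i => φ (m + i + 1) - φ (m + i) - ν with hθ'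
  set c : ℕ → ℂ := fun i => cKL (θ' i) with hc
  have hinj : ∀ i ∈ range (L + 1), ∀ j ∈ range (L + 1), m + (i : ℤ) = m + (j : ℤ) → i = j := by
    intro i _ j _ hij
    exact_mod_cast (add_left_cancel hij)
  have hsum : ∑ n ∈ Finset.Icc m (m + L), e (φ n) = ∑ i ∈ range (L + 1), z i := by
    have hI : Finset.Icc m (m + L) = (range (L + 1)).image (fun i : ℕ => m + (i : ℤ)) := by
      ext n
      simp only [Finset.mem_Icc, Finset.mem_image, Finset.mem_range]
      constructor
      · rintro ⟨h1, h2⟩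
        exact ⟨(n - m).toNat, by omega, by omega⟩
      · rintro ⟨i, hi, rfl⟩
        omega
    rw [hI, Finset.sum_image hinj]
  rw [hsum]
  -- properties of θ': λ ≤ θ' ≤ 1 - μ, hence 0 < θ' < 1 and sin(πθ') > 0
  have hlm : lam + mu ≤ 1 := by
    have := hθ m le_rfl hmM; linarith [this.1, this.2]
  have hθ'1 : ∀ i, i < L → lam ≤ θ' i ∧ θ' i ≤ 1 - mu := by
    intro i hi
    have := hθ (m + i) (by omega) (by omega)
    simp only [hθ']
    constructor <;> linarith [this.1, this.2]
  have hθ'pos : ∀ i, i < L → 0 < θ' i ∧ θ' i < 1 := fun i hi =>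
    ⟨by linarith [(hθ'1 i hi).1], by linarith [(hθ'1 i hi).2]⟩
  have hsinpos : ∀ i, i < L → 0 < Real.sin (π * θ' i) := fun i hi =>
    Real.sin_pos_of_pos_of_lt_pi (by nlinarith [(hθ'pos i hi).1])
      (by nlinarith [(hθ'pos i hi).2])
  have hθ'mono : ∀ i, i + 1 < L → θ' i ≤ θ' (i + 1) := by
    intro i hi
    have := hmono (m + i) (by omega) (by omega)
    simp only [hθ']
    push_cast
    have e1 : m + ((i : ℤ) + 1) + 1 = m + i + 2 := by ring
    have e2 : m + ((i : ℤ) + 1) = m + i + 1 := by ring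
    rw [e1, e2]
    linarith
  have hθ'mono' : ∀ i j, i ≤ j → j < L → θ' i ≤ θ' j := by
    intro i j hij hj
    induction j, hij using Nat.le_induction with
    | base => exact le_rfl
    | succ j hij ih => exact (ih (by omega)).trans (hθ'mono j hj)
  -- the recursion z i = c i * (z (i+1) - z i)
  have hrec : ∀ i, i < L → z i = c i * (z (i + 1) - z i) := by
    intro i hi
    have hs : Real.sin (π * θ' i) ≠ 0 := (hsinpos i hi).ne'
    have hstep : z (i + 1) = z i * e (θ' i) := by
      simp only [hz, hθ']
      rw [← e_add]
      have e3 : m + ((i + 1 : ℕ) : ℤ) = m + i + 1 := by push_cast; ring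
      rw [e3]
      have : φ (m + i) + (φ (m + i + 1) - φ (m + i) - ν) = φ (m + i + 1) - (ν : ℝ) := by ring
      rw [this, e_sub_int]
    have key : c i * (e (θ' i) - 1) = 1 := cKL_mul_e_sub_one hs
    rw [hstep]
    linear_combination (-(z i)) * key
  have hz1 : ∀ i, ‖z i‖ = 1 := fun i => norm_e _
  -- Abel summation: ∑_{i ≤ L} z i = (c (L-1) + 1) z L - c 0 z 0 + ∑_{1 ≤ i < L} (c (i-1) - c i) z i
  rw [sum_range_succ, abel_KL z c L hLpos hrec]
  have hregroup : c (L - 1) * z L - c 0 * z 0 + ∑ i ∈ Ico 1 L, (c (i - 1) - c i) * z i + z L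
      = (c (L - 1) + 1) * z L - c 0 * z 0 + ∑ i ∈ Ico 1 L, (c (i - 1) - c i) * z i := by ring
  rw [hregroup]
  -- telescoping bound for the middle sum
  have hmid : ∀ K, 1 ≤ K → K ≤ L →
      ∑ i ∈ Ico 1 K, ‖(c (i - 1) - c i) * z i‖ ≤ (cotπ (θ' 0) - cotπ (θ' (K - 1))) / 2 := by
    intro K hK hKL
    induction K, hK using Nat.le_induction with
    | base => simp
    | succ K hK ih =>
      rw [sum_Ico_succ_top hK, Nat.add_sub_cancel]
      have ih' := ih (Nat.le_of_succ_le hKL)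
      have hKm : K - 1 + 1 = K := Nat.sub_add_cancel hK
      have hmono' : θ' (K - 1) ≤ θ' K := by
        have := hθ'mono (K - 1) (by omega)
        rwa [hKm] at this
      have hlamK : lam ≤ θ' (K - 1) := (hθ'1 (K - 1) (by omega)).1
      have hmuK : θ' K ≤ 1 - mu := (hθ'1 K (by omega)).2
      have hanti : cotπ (θ' K) ≤ cotπ (θ' (K - 1)) :=
        cot_anti (δ := min lam mu) (lt_min hlam hmu) ((min_le_left _ _).trans hlamK)
          (hmuK.trans (by linarith [min_le_right lam mu])) hmono'
      have hterm : ‖(c (K - 1) - c K) * z K‖ = (cotπ (θ' (K - 1)) - cotπ (θ' K)) / 2 := by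
        rw [norm_mul, hz1, mul_one]
        show ‖cKL (θ' (K - 1)) - cKL (θ' K)‖ = _
        rw [norm_cKL_sub_cKL, abs_of_nonpos (by linarith)]
        ring
      rw [hterm]
      linarith
  have hmidL := hmid L hLpos le_rfl
  -- the two boundary terms, exactly
  have hB : ‖(c (L - 1) + 1) * z L‖ = 1 / (2 * Real.sin (π * θ' (L - 1))) := by
    rw [norm_mul, hz1, mul_one]
    show ‖cKL (θ' (L - 1)) + 1‖ = _
    rw [norm_cKL_add_one (hsinpos _ (by omega)).ne', norm_cKL_eq (hsinpos _ (by omega)).ne',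
      abs_of_pos (hsinpos _ (by omega))]
  have hC : ‖c 0 * z 0‖ = 1 / (2 * Real.sin (π * θ' 0)) := by
    rw [norm_mul, hz1, mul_one]
    show ‖cKL (θ' 0)‖ = _
    rw [norm_cKL_eq (hsinpos _ (by omega)).ne', abs_of_pos (hsinpos _ (by omega))]
  -- half-angle forms
  have h0pos := hθ'pos 0 (by omega)
  have hLpos' := hθ'pos (L - 1) (by omega)
  have hhalf0 : 1 / (2 * Real.sin (π * θ' 0)) + cotπ (θ' 0) / 2 = Real.cot (π * θ' 0 / 2) / 2 := by
    have := inv_sin_add_cotπ h0pos.1 h0pos.2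
    have hs := (hsinpos 0 (by omega)).ne'
    field_simp at this ⊢
    linarith
  have hhalfL : 1 / (2 * Real.sin (π * θ' (L - 1))) - cotπ (θ' (L - 1)) / 2
      = Real.tan (π * θ' (L - 1) / 2) / 2 := by
    have := inv_sin_sub_cotπ hLpos'.1 hLpos'.2
    have hs := (hsinpos (L - 1) (by omega)).ne'
    field_simp at this ⊢
    linarith
  -- monotone comparison with the end-points λ, 1 - μ
  have hcot0 : Real.cot (π * θ' 0 / 2) ≤ Real.cot (π * lam / 2) :=
    cot_le_cot (by positivity) (by nlinarith [(hθ'1 0 (by omega)).1]) (by nlinarith [h0pos.2])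
  have htanL : Real.tan (π * θ' (L - 1) / 2) ≤ Real.cot (π * mu / 2) :=
    tan_le_cot_of_le_one_sub hLpos'.1 hmu (hθ'1 (L - 1) (by omega)).2
  calc ‖(c (L - 1) + 1) * z L - c 0 * z 0 + ∑ i ∈ Ico 1 L, (c (i - 1) - c i) * z i‖
      ≤ ‖(c (L - 1) + 1) * z L‖ + ‖c 0 * z 0‖ + ‖∑ i ∈ Ico 1 L, (c (i - 1) - c i) * z i‖ := by
        refine (norm_add_le _ _).trans ?_
        gcongr
        exact norm_sub_le _ _
    _ ≤ 1 / (2 * Real.sin (π * θ' (L - 1))) + 1 / (2 * Real.sin (π * θ' 0))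
          + (cotπ (θ' 0) - cotπ (θ' (L - 1))) / 2 := by
        rw [hB, hC]
        gcongr
        exact (norm_sum_le _ _).trans hmidL
    _ = Real.cot (π * θ' 0 / 2) / 2 + Real.tan (π * θ' (L - 1) / 2) / 2 := by
        linear_combination hhalf0 + hhalfL
    _ ≤ (Real.cot (π * lam / 2) + Real.cot (π * mu / 2)) / 2 := by linarith

/-- The sum of `e(-φ(n))` is the conjugate of the sum of `e(φ(n))`, so has the same norm.
[folklore] -/
theorem norm_sum_e_neg (T : Finset ℤ) (φ : ℤ → ℝ) :
    ‖∑ n ∈ T, e (-φ n)‖ = ‖∑ n ∈ T, e (φ n)‖ := by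
  have : ∑ n ∈ T, e (-φ n) = (starRingEnd ℂ) (∑ n ∈ T, e (φ n)) := by
    rw [map_sum]
    exact Finset.sum_congr rfl fun n _ => e_neg _
  rw [this, Complex.norm_conj]

/-- **Sharp Kusmin–Landau inequality, discrete form, nonincreasing increments**: as
`kusminLandau_cot` with `θ` nonincreasing on `m ≤ n < M`. [cite: HiaryPatelYang2024, Lemma 2.3] -/
theorem kusminLandau_cot' {φ : ℤ → ℝ} {m M ν : ℤ} {lam mu : ℝ} (hlam : 0 < lam) (hmu : 0 < mu)
    (hmM : m < M)
    (hθ : ∀ n : ℤ, m ≤ n → n < M →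
      (ν : ℝ) + lam ≤ φ (n + 1) - φ n ∧ φ (n + 1) - φ n ≤ ν + 1 - mu)
    (hmono : ∀ n : ℤ, m ≤ n → n + 1 < M → φ (n + 2) - φ (n + 1) ≤ φ (n + 1) - φ n) :
    ‖∑ n ∈ Finset.Icc m M, e (φ n)‖ ≤ (Real.cot (π * lam / 2) + Real.cot (π * mu / 2)) / 2 := by
  rw [← norm_sum_e_neg]
  have h := kusminLandau_cot (φ := fun n => -φ n) (ν := -ν - 1) (lam := mu) (mu := lam) hmu hlam
    hmM (fun n h1 h2 => ?_) (fun n h1 h2 => ?_)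
  · rwa [add_comm (Real.cot (π * mu / 2))] at h
  · have := hθ n h1 h2
    push_cast
    constructor <;> linarith [this.1, this.2]
  · have := hmono n h1 h2
    linarith

/-- **Sharp Kusmin–Landau inequality with the bound `(λ⁻¹ + μ⁻¹)/π`** (Hiary–Patel–Yang 2024,
Lemma 2.3; Yang 2024, (2.3)): increments in `[ν + λ, ν + 1 - μ]`, monotone (either sense) on
`m ≤ n < M`, `λ + μ ≤ 1`; then `‖∑_{n=m}^{M} e(φ(n))‖ ≤ (1/λ + 1/μ)/π`.
[cite: HiaryPatelYang2024, Lemma 2.3] -/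
theorem kusminLandau_sharp {φ : ℤ → ℝ} {m M ν : ℤ} {lam mu : ℝ} (hlam : 0 < lam) (hmu : 0 < mu)
    (hlm : lam + mu ≤ 1)
    (hθ : ∀ n : ℤ, m ≤ n → n < M →
      (ν : ℝ) + lam ≤ φ (n + 1) - φ n ∧ φ (n + 1) - φ n ≤ ν + 1 - mu)
    (hmono : (∀ n : ℤ, m ≤ n → n + 1 < M → φ (n + 1) - φ n ≤ φ (n + 2) - φ (n + 1)) ∨
      (∀ n : ℤ, m ≤ n → n + 1 < M → φ (n + 2) - φ (n + 1) ≤ φ (n + 1) - φ n)) :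
    ‖∑ n ∈ Finset.Icc m M, e (φ n)‖ ≤ (1 / lam + 1 / mu) / π := by
  have hπ := Real.pi_pos
  have hlam1 : lam < 1 := by linarith
  have hmu1 : mu < 1 := by linarith
  have hcotb : (Real.cot (π * lam / 2) + Real.cot (π * mu / 2)) / 2 ≤ (1 / lam + 1 / mu) / π := by
    have h1 := cot_pi_mul_div_two_le hlam hlam1
    have h2 := cot_pi_mul_div_two_le hmu hmu1
    have e : (1 / lam + 1 / mu) / π = (2 / (π * lam) + 2 / (π * mu)) / 2 := by
      field_simp
    rw [e]; linarith
  rcases lt_trichotomy M m with hMm | rfl | hmM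
  · rw [Finset.Icc_eq_empty (not_le.2 hMm), sum_empty, norm_zero]; positivity
  · rw [Finset.Icc_self, sum_singleton, norm_e]
    -- `1 ≤ (1/λ + 1/μ)/π` from `λ + μ ≤ 1`: `1/λ + 1/μ ≥ 4/(λ+μ) ≥ 4 > π`
    rw [le_div_iff₀ hπ, one_mul]
    have h4 : (4 : ℝ) ≤ 1 / lam + 1 / mu := by
      rw [div_add_div _ _ hlam.ne' hmu.ne', le_div_iff₀ (by positivity)]
      nlinarith [sq_nonneg (lam - mu)]
    linarith [Real.pi_lt_four]
  · rcases hmono with hmono | hmono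
    · exact (kusminLandau_cot hlam hmu hmM hθ hmono).trans hcotb
    · exact (kusminLandau_cot' hlam hmu hmM hθ hmono).trans hcotb

/-! ### The form for a differentiable phase with monotone derivative -/

/-- **Hiary–Patel–Yang's Lemma 2.3 (sharp generalised Kusmin–Landau / Cheng–Graham lemma)**, for
sums over the integers of a closed interval: let `f` be differentiable on `[a, b]` (`a ≤ b` reals)
with `f'` monotone (nondecreasing or nonincreasing) on `[a, b]` and
`ν + λ ≤ f'(y) ≤ ν + 1 - μ` there (`ν ∈ ℤ`, `λ, μ > 0`). Then
`‖∑_{a ≤ n ≤ b} e(f(n))‖ ≤ (λ⁻¹ + μ⁻¹)/π`. (The printed lemma sums over `a ≤ n < b` under the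
hypothesis on `[a, b)`; apply this version on `[a, b']`, `b'` the last integer `< b`.)
[cite: HiaryPatelYang2024, Lemma 2.3] -/
theorem kusminLandau_deriv {f f' : ℝ → ℝ} {a b : ℝ} {ν : ℤ} {lam mu : ℝ} (hlam : 0 < lam)
    (hmu : 0 < mu) (hf : ∀ y ∈ Set.Icc a b, HasDerivAt f (f' y) y)
    (hmono : MonotoneOn f' (Set.Icc a b) ∨ AntitoneOn f' (Set.Icc a b))
    (hbd : ∀ y ∈ Set.Icc a b, (ν : ℝ) + lam ≤ f' y ∧ f' y ≤ ν + 1 - mu) :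
    ‖∑ n ∈ Finset.Icc ⌈a⌉ ⌊b⌋, e (f n)‖ ≤ (1 / lam + 1 / mu) / π := by
  set m : ℤ := ⌈a⌉ with hm
  set M : ℤ := ⌊b⌋ with hM
  rcases lt_or_ge M m with hMm | hmM
  · rw [Finset.Icc_eq_empty (not_le.2 hMm), sum_empty, norm_zero]
    exact div_nonneg (by positivity) Real.pi_pos.le
  have ham : a ≤ m := Int.le_ceil a
  have hMb : (M : ℝ) ≤ b := Int.floor_le b
  have hmM' : ((m : ℤ) : ℝ) ≤ M := by exact_mod_cast hmM
  have hlm : lam + mu ≤ 1 := by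
    have := hbd m ⟨ham, hmM'.trans hMb⟩; linarith [this.1, this.2]
  have hstep : ∀ n : ℤ, m ≤ n → n + 1 ≤ M →
      ∃ ξ : ℝ, (n : ℝ) < ξ ∧ ξ < n + 1 ∧ f' ξ = f ((n : ℝ) + 1) - f n := by
    intro n h1 h2
    have h1' : ((m : ℤ) : ℝ) ≤ n := by exact_mod_cast h1
    have h2' : ((n : ℤ) : ℝ) + 1 ≤ M := by exact_mod_cast h2
    -- increments of `f` are values of `f'` (mean value theorem on `[n, n+1]`,
    -- `exists_deriv_eq_step`), hence ordered like the points and in `[ν + λ, ν + 1 - μ]`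
    exact exists_deriv_eq_step hf (by linarith) (by linarith)
  refine kusminLandau_sharp (φ := fun n : ℤ => f n) (ν := ν) hlam hmu hlm ?_ ?_
  · intro n h1 h2
    obtain ⟨ξ, hξ1, hξ2, hξ⟩ := hstep n h1 (by omega)
    have h1r : ((m : ℤ) : ℝ) ≤ n := by exact_mod_cast h1
    have h2r : ((n : ℤ) : ℝ) + 1 ≤ M := by exact_mod_cast (show n + 1 ≤ M by omega)
    have hξI : ξ ∈ Set.Icc a b := ⟨by linarith, by linarith⟩
    have e1 : f ((n + 1 : ℤ) : ℝ) - f n = f' ξ := by rw [hξ]; push_cast; ring_nf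
    rw [e1]
    exact hbd ξ hξI
  · rcases hmono with hmono | hmono
    · left
      intro n h1 h2
      obtain ⟨ξ₁, hξ11, hξ12, hξ1⟩ := hstep n h1 (by omega)
      obtain ⟨ξ₂, hξ21, hξ22, hξ2⟩ := hstep (n + 1) (by omega) (by omega)
      push_cast at hξ21 hξ22 hξ2
      have h1r : ((m : ℤ) : ℝ) ≤ n := by exact_mod_cast h1
      have h2r : ((n : ℤ) : ℝ) + 2 ≤ M := by exact_mod_cast (show n + 2 ≤ M by omega)
      have hξ1I : ξ₁ ∈ Set.Icc a b := ⟨by linarith, by linarith⟩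
      have hξ2I : ξ₂ ∈ Set.Icc a b := ⟨by linarith, by linarith⟩
      have h12 := hmono hξ1I hξ2I (by linarith)
      have e1 : f ((n + 1 : ℤ) : ℝ) - f n = f' ξ₁ := by rw [hξ1]; push_cast; ring_nf
      have e2 : f ((n + 2 : ℤ) : ℝ) - f ((n + 1 : ℤ) : ℝ) = f' ξ₂ := by
        rw [hξ2]; push_cast; ring_nf
      rw [e1, e2]
      exact h12
    · right
      intro n h1 h2
      obtain ⟨ξ₁, hξ11, hξ12, hξ1⟩ := hstep n h1 (by omega)
      obtain ⟨ξ₂, hξ21, hξ22, hξ2⟩ := hstep (n + 1) (by omega) (by omega)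
      push_cast at hξ21 hξ22 hξ2
      have h1r : ((m : ℤ) : ℝ) ≤ n := by exact_mod_cast h1
      have h2r : ((n : ℤ) : ℝ) + 2 ≤ M := by exact_mod_cast (show n + 2 ≤ M by omega)
      have hξ1I : ξ₁ ∈ Set.Icc a b := ⟨by linarith, by linarith⟩
      have hξ2I : ξ₂ ∈ Set.Icc a b := ⟨by linarith, by linarith⟩
      have h12 := hmono hξ1I hξ2I (by linarith)
      have e1 : f ((n + 1 : ℤ) : ℝ) - f n = f' ξ₁ := by rw [hξ1]; push_cast; ring_nf
      have e2 : f ((n + 2 : ℤ) : ℝ) - f ((n + 1 : ℤ) : ℝ) = f' ξ₂ := by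
        rw [hξ2]; push_cast; ring_nf
      rw [e1, e2]
      exact h12

/-- The same over `a < n ≤ b` with integer end-points (the tree's convention `Finset.Ioc a b`,
Yang's `S_f(a, N)` with `b = a + N`): hypotheses on `[a + 1, b]` suffice, we ask them on `[a, b]`.
[cite: HiaryPatelYang2024, Lemma 2.3] -/
theorem kusminLandau_deriv_Ioc {f f' : ℝ → ℝ} {a b ν : ℤ} {lam mu : ℝ} (hlam : 0 < lam)
    (hmu : 0 < mu) (hf : ∀ y ∈ Set.Icc (a : ℝ) b, HasDerivAt f (f' y) y)
    (hmono : MonotoneOn f' (Set.Icc (a : ℝ) b) ∨ AntitoneOn f' (Set.Icc (a : ℝ) b))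
    (hbd : ∀ y ∈ Set.Icc (a : ℝ) b, (ν : ℝ) + lam ≤ f' y ∧ f' y ≤ ν + 1 - mu) :
    ‖∑ n ∈ Finset.Ioc a b, e (f n)‖ ≤ (1 / lam + 1 / mu) / π := by
  have hsub : Set.Icc ((a : ℝ) + 1) b ⊆ Set.Icc (a : ℝ) b := Set.Icc_subset_Icc (by linarith) le_rfl
  have h := kusminLandau_deriv (a := (a : ℝ) + 1) (b := (b : ℝ)) (ν := ν) hlam hmu
    (fun y hy => hf y (hsub hy))
    (hmono.imp (fun h => h.mono hsub) (fun h => h.mono hsub))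
    (fun y hy => hbd y (hsub hy))
  have e1 : ⌈((a : ℝ) + 1)⌉ = a + 1 := by
    rw [show (a : ℝ) + 1 = ((a + 1 : ℤ) : ℝ) by push_cast; ring, Int.ceil_intCast]
  have e2 : ⌊((b : ℤ) : ℝ)⌋ = b := Int.floor_intCast b
  rw [e1, e2] at h
  rwa [← Finset.Icc_add_one_left_eq_Ioc]

/-- **The symmetric case** (Landau; Yang 2024, (2.2)): `ν + λ ≤ f' ≤ ν + 1 - λ`, `f'` monotone
on `[a, b]`; then `‖∑_{a < n ≤ b} e(f(n))‖ ≤ 2/(πλ)`. [cite: HiaryPatelYang2024, Lemma 2.3] -/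
theorem kusminLandau_deriv_symm {f f' : ℝ → ℝ} {a b ν : ℤ} {lam : ℝ} (hlam : 0 < lam)
    (hf : ∀ y ∈ Set.Icc (a : ℝ) b, HasDerivAt f (f' y) y)
    (hmono : MonotoneOn f' (Set.Icc (a : ℝ) b) ∨ AntitoneOn f' (Set.Icc (a : ℝ) b))
    (hbd : ∀ y ∈ Set.Icc (a : ℝ) b, (ν : ℝ) + lam ≤ f' y ∧ f' y ≤ ν + 1 - lam) :
    ‖∑ n ∈ Finset.Ioc a b, e (f n)‖ ≤ 2 / (π * lam) := by
  have h := kusminLandau_deriv_Ioc hlam hlam hf hmono hbd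
  have e : (1 / lam + 1 / lam) / π = 2 / (π * lam) := by field_simp; ring
  rwa [e] at h

end VdC
end Literature.NumberTheory.LFunctions
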